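import Summits.QuantumFields.YangMills.Theorems.BalabanUVNodesN20CoreEdgeAtShellSplitOfRecord

/-!
# BalabanUVNodes ∕ N20 (NE7b) — the `hedge`-JOINT COMPANION, module 8: the TRANSFERS — N19′'s core-edge face AT `crOfRecord₁₃At K₀ jcut (shellSplitOfRecord₁₃At N K₀ ρA ρB)`
# and AT the physical-volume reading `crOfRecord₁₃VAt …` FROM the term-core ∕ lowered-threshold sandwich of module 7, the sign letter `hP0` DISCHARGED; and ON THE
# LIVE-SELECTOR LINE (K3⁷ v2's `PinnedAtLive` line) with F3's (e1) integrability discharged too (dag-n21-d FILE 3 §6)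

Cell `pub-ymgap` (HUMAN RULING D-0062 Track A; D-0149 width push), seat `pub-ymgap-dag-n20-w3` (WIDTH SEAT 3 of 3 on NODE n20 = NE7b) gen 2, INTENT-7 (pub-ymgap INBOX l.26290),
FILE B — the companion of `Thm/BalabanUVNodesN20CoreEdgeAtShellSplitOfRecord` (module 7), split off at the 400-line rule.  Filed `--kind proof --supports
stmt-QuantumFields-20544 --as helper` (K3⁷ `SpineGivenEndpointR13SepCoPH`); COUNT-NEUTRAL.  [III] = [Balaban1988Convergent], [LF-I∕II] = [Balaban1989LargeFieldI∕II].

WHAT IS PROVED (one application of dag-n20-d's `core_crOfRecord₁₃At ∕ core_crOfRecord₁₃VAt` each, `hP0 :=` module 7's `weightA₁₃_sub_shellA₁₃_nonneg`, `h :=` module 7's iff).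
* §3 `core_crOfRecord₁₃At_shellSplit_of_termCore` ∕ `core_crOfRecord₁₃VAt_shellSplit_of_termCore`: DISPLAYED `hM : 0 < θ.τ9.M`, the flow hypothesis `hR` on the record's
  histories, the policy letters `1 ≤ jcut K ≤ K₀ + K`, the width letters `ρA ρB : WidthLetter₁₃CoPH N` (dag-n21-d), a summable `δ`, F3's (e1) integrability of run A's top
  pieces, and THE TERM-CORE SANDWICH «`e^{c ∓ vol·δ K}`-agreement of `cw_A(s) − σ_A(s)` with `cw_B(liftSeq s) − σ_B(liftSeq s)`, one `c` per `K`» on the run-A indices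
  that are small-field at every level `≤ jcut K` (`vol = 1`, resp. `F.side ^ 4`) ⇒ `NE7.Core … ∧ Summable …` at the reading's own carriers, bad class, shell split OF RECORD
  and CANONICAL rate — the core-edge conjunct of K3⁷ v2's stub 2 at `(jcut, shellSplitOfRecord₁₃At N K₀ ρA ρB)`.
* `core_crOfRecord₁₃At_shellSplit_of_loweredTerm` ∕ `core_crOfRecord₁₃VAt_shellSplit_of_loweredTerm`: the same from THE LOWERED-THRESHOLD SANDWICH «the (2.18) term of `s`
  at cutoff `K₀ + K` and of `liftSeq s` at cutoff `K₀ + K + 1`, both RE-TESTED at `ε_k(1 − ρ)`, agree up to `e^{c ∓ vol·δ K}`» — displayed in addition: (H-U), `0 ≤ ε·ρ` per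
  run, (e1) integrability of both runs' top pieces.
* §4 ★★★ `core_crOfRecord₁₃At_shellSplit_of_loweredTerm_liveSel` ∕ `core_crOfRecord₁₃VAt_shellSplit_of_loweredTerm_liveSel`: ON THE LIVE-SELECTOR LINE
  `θ.ppSel = ppSelLiveOfRecord … E (wOfRecord₉ θ.toStage9Params)` (the line of dag-n20-d's `keyedExtraction_crOfRecord₁₃At` and of K3⁷ v2's `PinnedAtLive`) the integrability
  rows are dag-n21-d's `integrable_topPieceA_of_liveSel ∕ …B…` (p593341; their `0 ≤ ζ` letter = the provisos' ζ-rows, n20-w2's `zeta_nonneg_of_provisos₁₃CoPH` p593923): the core-edge conjunct at the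
  split of record follows from (H-U), (H-ζ), `hM`, `hR`, the policy and width letters, `Summable δ`, and the lowered-threshold sandwich — NOTHING ELSE.  Together with n20-w2's
  `KeyedRelWeight` files (p590852, cut dial) and dag-n21-d's `shellWeightBound_crOfRecord₁₃At_shellSplit_of_liveSel` (N21 at the same split, per-cube (M1) displayed), this
  is the third K5 face of stub 2 typed AT ONE NAMED `(jcut, sh)` with every residual letter displayed and every bookkeeping row discharged.

HONEST FRAMING.  Count-neutral bookkeeping; nothing re-typed.  NO estimate is proved: the sandwich IS N19's NE7 core on small-field-at-old-levels histories at the record — NOT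
PRINTED for `d = 4` ([LF-II] p.356), NOT proved, NAMED OPEN; every theorem here has it as a HYPOTHESIS, inhabited by no Bałaban family today (A2 declared; the faces are
non-vacuous as statements — A6).  (α) READING banner as in module 7 (NC-NE7b-α UNRULED; the policy and the widths are the prover's dials, plan g81 rulings (a)).  NE7 ∕ NE7b ∕
NE7c NOT PRINTED ∕ NOT PROVED; (α)-instance 0∕1; N19 ∕ N20 ∕ N21 NOT discharged; K3⁷ NOT closed; counts unmoved (typed 28∕28 · discharged 5∕27); no count claim.  One finite
`𝕋⁴_{L^K}` programme at fixed `ε = L^{−K}` along two consecutive cutoffs, Bałaban AS PRINTED; the YM mass gap (Clay) is NOT proved by any of this — R4 closes the conditional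
finite-𝕋⁴ rung `BalabanLadder.UV` only; NOT ℝ⁴, NOT OS.  No `instance`, no `notation`, no `def`, no `sorry`, no private decls.  Sources (bookkeeping):
[III] (2.1) p.254, (2.5) p.255, (2.17)–(2.18) p.257; [LF-I] (0.2)–(0.4) p.176, p.193; [LF-II] Thm 1 + (0.1) pp.355–356, (1.80) p.384; [King1986] (3.10) p.656.
-/

noncomputable section

namespace Summit.QuantumFields.YangMills.BalabanUVNodes.N20CoreEdgeAtShellSplitTransfer

open Literature.MathematicalPhysics.QuantumFieldTheory.Balaban1983to89 Literature.MathematicalPhysics.QuantumFieldTheory.Balaban1983to89.T4Continuum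
open Literature.MathematicalPhysics.QuantumFieldTheory.Balaban1983to89.Node00
open scoped BigOperators
open MeasureTheory
open B14.Eq218Concrete Summit.QuantumFields.BalabanUV.T4Continuum.Spine
open YMDAG.UVSplit (crOfRecord₁₃At crOfRecord₁₃VAt crOfRecord₁₃ ShellSplit₁₃CoPH keyA₁₃ keyB₁₃ keyB₁₃_eq runA₁₃ runB₁₃ histA₁₃ histB₁₃ classSet₁₃
  weightA₁₃ weightB₁₃ badClass₁₃ core_crOfRecord₁₃At core_crOfRecord₁₃VAt)
open Summit.QuantumFields.YangMills.Theorems.N21ShellSplitOfRecord13CoPH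
open Summit.QuantumFields.YangMills.BalabanUVNodes.N20CoreEdgeAtShellSplit
open Summit.QuantumFields.YangMills.BalabanUVNodes.N21KeyedShellWeightShellZero (zeta_nonneg_of_provisos₁₃CoPH)

variable {F : T4Family} {N : ℕ} [NeZero N]
variable (θ : Stage13HParams F N) (hP : θ.Provisos₁₃CoPH F N) (K₀ : ℕ) (g₀ : ℕ → ℝ) (os : List (ULoop F))

/-! ## §3 The faces AT the reading: dag-n20-d's transfers `core_crOfRecord₁₃At ∕ core_crOfRecord₁₃VAt` at the shell split of record, sign letter DISCHARGED -/

section AtReading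

variable (hM : 0 < θ.τ9.M)

/-- **★★ N19′'s CORE EDGE AT `crOfRecord₁₃At K₀ jcut (shellSplitOfRecord₁₃At N K₀ ρA ρB)` FROM THE TERM-CORE SANDWICH, NO SIGN LETTER.**  DISPLAYED: `hM`, the flow
hypothesis `hR`, the policy letters `1 ≤ jcut K ≤ K₀ + K`, the width letters `ρA ρB` (dag-n21-d's `WidthLetter₁₃CoPH`), a summable `δ`, F3's (e1) integrability of run A's top
pieces for `|t| ≤ 1` (a theorem on the live-selector line), and THE SANDWICH of §2 at `(l₀, vol) = (1, 1)` — N19's NE7 core at the record, NOT PRINTED, NOT proved.  The sign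
letter `hP0` of dag-n20-d's transfer is §1's `weightA₁₃_sub_shellA₁₃_nonneg`.  CONCLUSION: `NE7.Core` at the reading's own carriers, bad class, shell split OF RECORD and
CANONICAL rate, `∧ Summable` — the core-edge conjunct of K3⁷ v2's stub 2 at `(jcut, shellSplitOfRecord₁₃At …)`.
[cite: King1986, (3.10) p.656; Balaban1989LargeFieldII, Thm 1 + (0.1) pp.355–356, (1.80) p.384; Balaban1988Convergent, (2.18) p.257; Balaban1989LargeFieldI, p.193 (bookkeeping)] -/
theorem core_crOfRecord₁₃At_shellSplit_of_termCore (hR : ∀ K, RAgree F θ.ν (histA₁₃ θ K₀ g₀ K) (histB₁₃ θ K₀ g₀ K) (K₀ + K))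
    (jcut : ℕ → ℕ) (hj1 : ∀ K, 1 ≤ jcut K) (hjK : ∀ K, jcut K ≤ K₀ + K) (ρA ρB : WidthLetter₁₃CoPH N) {δ : ℕ → ℝ} (hδ : Summable δ)
    (hintA : ∀ (K : ℕ) (t : ℝ) (s : SeqOfRecord F θ.ν θ.τ9.M (histA₁₃ θ K₀ g₀ K) (K₀ + K) (K₀ + K)),
      Integrable (fun V => chiSeqOfRecord F N θ.ν θ.τ9.M (histA₁₃ θ K₀ g₀ K) (K₀ + K) (K₀ + K) s V *
        dressedSlotsOfDatum₉ F N θ.toStage9Params (datumOfRecord₁₃CoPH F N θ hP) g₀ os t (runA₁₃ F K₀ g₀ K) (histA₁₃ θ K₀ g₀ K) (K₀ + K) s V)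
        (fieldMeasure (F.P (K₀ + K)) (K₀ + K) (Node00.SU N)))
    (hterm : ∀ K : ℕ, ∃ c : ℝ, ∀ t : ℝ, |t| ≤ 1 → ∀ s : SeqOfRecord F θ.ν θ.τ9.M (histA₁₃ θ K₀ g₀ K) (K₀ + K) (K₀ + K),
      (∀ j, 1 ≤ j → j ≤ jcut K → s.Λ j = Set.univ) →
      Real.exp (c - 1 * δ K) *
            (classWeightOfDatum₉ F N θ.toStage9Params (datumOfRecord₁₃CoPH F N θ hP) g₀ os (runA₁₃ F K₀ g₀ K) (histA₁₃ θ K₀ g₀ K) (K₀ + K) t s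
              - shellWeightOfDatum₉ F N θ.toStage9Params (datumOfRecord₁₃CoPH F N θ hP) g₀ os (runA₁₃ F K₀ g₀ K) (histA₁₃ θ K₀ g₀ K) (K₀ + K)
                  (ρA F θ hP g₀ os K) t s)
          ≤ classWeightOfDatum₉ F N θ.toStage9Params (datumOfRecord₁₃CoPH F N θ hP) g₀ os (runB₁₃ F K₀ g₀ K) (histB₁₃ θ K₀ g₀ K) (K₀ + K + 1) t
                (liftSeq F θ.ν hM (hR K) s)
              - shellWeightOfDatum₉ F N θ.toStage9Params (datumOfRecord₁₃CoPH F N θ hP) g₀ os (runB₁₃ F K₀ g₀ K) (histB₁₃ θ K₀ g₀ K) (K₀ + K + 1)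
                  (ρB F θ hP g₀ os K) t (liftSeq F θ.ν hM (hR K) s) ∧
        classWeightOfDatum₉ F N θ.toStage9Params (datumOfRecord₁₃CoPH F N θ hP) g₀ os (runB₁₃ F K₀ g₀ K) (histB₁₃ θ K₀ g₀ K) (K₀ + K + 1) t
                (liftSeq F θ.ν hM (hR K) s)
              - shellWeightOfDatum₉ F N θ.toStage9Params (datumOfRecord₁₃CoPH F N θ hP) g₀ os (runB₁₃ F K₀ g₀ K) (histB₁₃ θ K₀ g₀ K) (K₀ + K + 1)
                  (ρB F θ hP g₀ os K) t (liftSeq F θ.ν hM (hR K) s)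
          ≤ Real.exp (c + 1 * δ K) *
            (classWeightOfDatum₉ F N θ.toStage9Params (datumOfRecord₁₃CoPH F N θ hP) g₀ os (runA₁₃ F K₀ g₀ K) (histA₁₃ θ K₀ g₀ K) (K₀ + K) t s
              - shellWeightOfDatum₉ F N θ.toStage9Params (datumOfRecord₁₃CoPH F N θ hP) g₀ os (runA₁₃ F K₀ g₀ K) (histA₁₃ θ K₀ g₀ K) (K₀ + K)
                  (ρA F θ hP g₀ os K) t s)) :
    (letI := (crOfRecord₁₃At K₀ jcut (shellSplitOfRecord₁₃At N K₀ ρA ρB) F θ hP g₀ os).dec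
     NE7.Core (crOfRecord₁₃At K₀ jcut (shellSplitOfRecord₁₃At N K₀ ρA ρB) F θ hP g₀ os).l₀
      (crOfRecord₁₃At K₀ jcut (shellSplitOfRecord₁₃At N K₀ ρA ρB) F θ hP g₀ os).vol (crOfRecord₁₃At K₀ jcut (shellSplitOfRecord₁₃At N K₀ ρA ρB) F θ hP g₀ os).T
      (crOfRecord₁₃At K₀ jcut (shellSplitOfRecord₁₃At N K₀ ρA ρB) F θ hP g₀ os).Bad
      (fun K t τ => (crOfRecord₁₃At K₀ jcut (shellSplitOfRecord₁₃At N K₀ ρA ρB) F θ hP g₀ os).A K t τ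
        - (crOfRecord₁₃At K₀ jcut (shellSplitOfRecord₁₃At N K₀ ρA ρB) F θ hP g₀ os).shA K t τ)
      (fun K t τ => (crOfRecord₁₃At K₀ jcut (shellSplitOfRecord₁₃At N K₀ ρA ρB) F θ hP g₀ os).B K t τ
        - (crOfRecord₁₃At K₀ jcut (shellSplitOfRecord₁₃At N K₀ ρA ρB) F θ hP g₀ os).shB K t τ)
      (crOfRecord₁₃At K₀ jcut (shellSplitOfRecord₁₃At N K₀ ρA ρB) F θ hP g₀ os).δ) ∧
      Summable (crOfRecord₁₃At K₀ jcut (shellSplitOfRecord₁₃At N K₀ ρA ρB) F θ hP g₀ os).δ :=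
  core_crOfRecord₁₃At K₀ jcut (shellSplitOfRecord₁₃At N K₀ ρA ρB) θ hP g₀ os
    (fun K t _ x _ => weightA₁₃_sub_shellA₁₃_nonneg θ hP K₀ g₀ os (ρA F θ hP g₀ os) hintA K t x)
    ((core_shellSplit₁₃_iff_termCore θ hP K₀ g₀ os hM hR jcut hj1 hjK (ρA F θ hP g₀ os) (ρB F θ hP g₀ os) 1 1 δ).2 hterm) hδ

/-- **★★ N19′'s CORE EDGE AT `crOfRecord₁₃At K₀ jcut (shellSplitOfRecord₁₃At N K₀ ρA ρB)` FROM THE LOWERED-THRESHOLD SANDWICH, NO SIGN LETTER** — §2's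
`core_shellSplit₁₃_iff_loweredTerm` fed to dag-n20-d's transfer.  DISPLAYED: `hM`, `hR`, the policy letters, the width letters with `0 ≤ ε·ρ` per run, (H-U), F3's (e1)
integrability of both runs' top pieces, a summable `δ`, and THE SANDWICH of the two runs' (2.18) terms RE-TESTED AT THE LOWERED THRESHOLDS, term vs lifted term, on the
small-field-at-old-levels histories — N19's NE7 core at the record in its definite form (NOT PRINTED, NOT proved).
[cite: King1986, (3.10) p.656; Balaban1989LargeFieldII, Thm 1 + (0.1) pp.355–356, (1.80) p.384; Balaban1988Convergent, (2.17)–(2.18) p.257; Balaban1989LargeFieldI, p.193 (bookkeeping)] -/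
theorem core_crOfRecord₁₃At_shellSplit_of_loweredTerm (hR : ∀ K, RAgree F θ.ν (histA₁₃ θ K₀ g₀ K) (histB₁₃ θ K₀ g₀ K) (K₀ + K))
    (jcut : ℕ → ℕ) (hj1 : ∀ K, 1 ≤ jcut K) (hjK : ∀ K, jcut K ≤ K₀ + K) (ρA ρB : WidthLetter₁₃CoPH N) {δ : ℕ → ℝ} (hδ : Summable δ)
    (hU : LocalBgMeasurable F N θ.ν)
    (hρA : ∀ K, 0 ≤ epsOfRecord θ.ν (histA₁₃ θ K₀ g₀ K) (K₀ + K) * ρA F θ hP g₀ os K)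
    (hρB : ∀ K, 0 ≤ epsOfRecord θ.ν (histB₁₃ θ K₀ g₀ K) (K₀ + K + 1) * ρB F θ hP g₀ os K)
    (hintA : ∀ (K : ℕ) (t : ℝ) (s : SeqOfRecord F θ.ν θ.τ9.M (histA₁₃ θ K₀ g₀ K) (K₀ + K) (K₀ + K)),
      Integrable (fun V => chiSeqOfRecord F N θ.ν θ.τ9.M (histA₁₃ θ K₀ g₀ K) (K₀ + K) (K₀ + K) s V *
        dressedSlotsOfDatum₉ F N θ.toStage9Params (datumOfRecord₁₃CoPH F N θ hP) g₀ os t (runA₁₃ F K₀ g₀ K) (histA₁₃ θ K₀ g₀ K) (K₀ + K) s V)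
        (fieldMeasure (F.P (K₀ + K)) (K₀ + K) (Node00.SU N)))
    (hintB : ∀ (K : ℕ) (t : ℝ) (s' : SeqOfRecord F θ.ν θ.τ9.M (histB₁₃ θ K₀ g₀ K) (K₀ + K + 1) (K₀ + K + 1)),
      Integrable (fun V => chiSeqOfRecord F N θ.ν θ.τ9.M (histB₁₃ θ K₀ g₀ K) (K₀ + K + 1) (K₀ + K + 1) s' V *
        dressedSlotsOfDatum₉ F N θ.toStage9Params (datumOfRecord₁₃CoPH F N θ hP) g₀ os t (runB₁₃ F K₀ g₀ K) (histB₁₃ θ K₀ g₀ K) (K₀ + K + 1) s' V)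
        (fieldMeasure (F.P (K₀ + K + 1)) (K₀ + K + 1) (Node00.SU N)))
    (hlow : ∀ K : ℕ, ∃ c : ℝ, ∀ t : ℝ, |t| ≤ 1 → ∀ s : SeqOfRecord F θ.ν θ.τ9.M (histA₁₃ θ K₀ g₀ K) (K₀ + K) (K₀ + K),
      (∀ j, 1 ≤ j → j ≤ jcut K → s.Λ j = Set.univ) →
      Real.exp (c - 1 * δ K) *
            (∫ V, chiSeqOfRecordAt F N θ.ν θ.τ9.M (histA₁₃ θ K₀ g₀ K) (K₀ + K) (K₀ + K)
                (epsOfRecord θ.ν (histA₁₃ θ K₀ g₀ K) (K₀ + K) * (1 - ρA F θ hP g₀ os K)) s V *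
              dressedSlotsOfDatum₉ F N θ.toStage9Params (datumOfRecord₁₃CoPH F N θ hP) g₀ os t (runA₁₃ F K₀ g₀ K) (histA₁₃ θ K₀ g₀ K) (K₀ + K) s V
              ∂fieldMeasure (F.P (K₀ + K)) (K₀ + K) (Node00.SU N))
          ≤ (∫ V, chiSeqOfRecordAt F N θ.ν θ.τ9.M (histB₁₃ θ K₀ g₀ K) (K₀ + K + 1) (K₀ + K + 1)
                (epsOfRecord θ.ν (histB₁₃ θ K₀ g₀ K) (K₀ + K + 1) * (1 - ρB F θ hP g₀ os K)) (liftSeq F θ.ν hM (hR K) s) V *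
              dressedSlotsOfDatum₉ F N θ.toStage9Params (datumOfRecord₁₃CoPH F N θ hP) g₀ os t (runB₁₃ F K₀ g₀ K) (histB₁₃ θ K₀ g₀ K) (K₀ + K + 1)
                (liftSeq F θ.ν hM (hR K) s) V
              ∂fieldMeasure (F.P (K₀ + K + 1)) (K₀ + K + 1) (Node00.SU N)) ∧
        (∫ V, chiSeqOfRecordAt F N θ.ν θ.τ9.M (histB₁₃ θ K₀ g₀ K) (K₀ + K + 1) (K₀ + K + 1)
                (epsOfRecord θ.ν (histB₁₃ θ K₀ g₀ K) (K₀ + K + 1) * (1 - ρB F θ hP g₀ os K)) (liftSeq F θ.ν hM (hR K) s) V *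
              dressedSlotsOfDatum₉ F N θ.toStage9Params (datumOfRecord₁₃CoPH F N θ hP) g₀ os t (runB₁₃ F K₀ g₀ K) (histB₁₃ θ K₀ g₀ K) (K₀ + K + 1)
                (liftSeq F θ.ν hM (hR K) s) V
              ∂fieldMeasure (F.P (K₀ + K + 1)) (K₀ + K + 1) (Node00.SU N))
          ≤ Real.exp (c + 1 * δ K) *
            (∫ V, chiSeqOfRecordAt F N θ.ν θ.τ9.M (histA₁₃ θ K₀ g₀ K) (K₀ + K) (K₀ + K)
                (epsOfRecord θ.ν (histA₁₃ θ K₀ g₀ K) (K₀ + K) * (1 - ρA F θ hP g₀ os K)) s V *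
              dressedSlotsOfDatum₉ F N θ.toStage9Params (datumOfRecord₁₃CoPH F N θ hP) g₀ os t (runA₁₃ F K₀ g₀ K) (histA₁₃ θ K₀ g₀ K) (K₀ + K) s V
              ∂fieldMeasure (F.P (K₀ + K)) (K₀ + K) (Node00.SU N))) :
    (letI := (crOfRecord₁₃At K₀ jcut (shellSplitOfRecord₁₃At N K₀ ρA ρB) F θ hP g₀ os).dec
     NE7.Core (crOfRecord₁₃At K₀ jcut (shellSplitOfRecord₁₃At N K₀ ρA ρB) F θ hP g₀ os).l₀
      (crOfRecord₁₃At K₀ jcut (shellSplitOfRecord₁₃At N K₀ ρA ρB) F θ hP g₀ os).vol (crOfRecord₁₃At K₀ jcut (shellSplitOfRecord₁₃At N K₀ ρA ρB) F θ hP g₀ os).T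
      (crOfRecord₁₃At K₀ jcut (shellSplitOfRecord₁₃At N K₀ ρA ρB) F θ hP g₀ os).Bad
      (fun K t τ => (crOfRecord₁₃At K₀ jcut (shellSplitOfRecord₁₃At N K₀ ρA ρB) F θ hP g₀ os).A K t τ
        - (crOfRecord₁₃At K₀ jcut (shellSplitOfRecord₁₃At N K₀ ρA ρB) F θ hP g₀ os).shA K t τ)
      (fun K t τ => (crOfRecord₁₃At K₀ jcut (shellSplitOfRecord₁₃At N K₀ ρA ρB) F θ hP g₀ os).B K t τ
        - (crOfRecord₁₃At K₀ jcut (shellSplitOfRecord₁₃At N K₀ ρA ρB) F θ hP g₀ os).shB K t τ)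
      (crOfRecord₁₃At K₀ jcut (shellSplitOfRecord₁₃At N K₀ ρA ρB) F θ hP g₀ os).δ) ∧
      Summable (crOfRecord₁₃At K₀ jcut (shellSplitOfRecord₁₃At N K₀ ρA ρB) F θ hP g₀ os).δ :=
  core_crOfRecord₁₃At K₀ jcut (shellSplitOfRecord₁₃At N K₀ ρA ρB) θ hP g₀ os
    (fun K t _ x _ => weightA₁₃_sub_shellA₁₃_nonneg θ hP K₀ g₀ os (ρA F θ hP g₀ os) hintA K t x)
    ((core_shellSplit₁₃_iff_loweredTerm θ hP K₀ g₀ os hM hR jcut hj1 hjK (ρA F θ hP g₀ os) (ρB F θ hP g₀ os) 1 1 δ hU hρA hρB hintA hintB).2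
      hlow) hδ

/-- **★★ THE SAME AT THE PHYSICAL-VOLUME READING `crOfRecord₁₃VAt K₀ jcut (shellSplitOfRecord₁₃At N K₀ ρA ρB)`** (exponents `c ∓ F.side^4·δ K`; dag-n20-d's
`core_crOfRecord₁₃VAt`). [cite: King1986, (3.10) p.656; Balaban1989LargeFieldII, Thm 1 + (0.1) pp.355–356, (1.80) p.384; Balaban1988Convergent, (2.18) p.257 (bookkeeping)] -/
theorem core_crOfRecord₁₃VAt_shellSplit_of_termCore (hR : ∀ K, RAgree F θ.ν (histA₁₃ θ K₀ g₀ K) (histB₁₃ θ K₀ g₀ K) (K₀ + K))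
    (jcut : ℕ → ℕ) (hj1 : ∀ K, 1 ≤ jcut K) (hjK : ∀ K, jcut K ≤ K₀ + K) (ρA ρB : WidthLetter₁₃CoPH N) {δ : ℕ → ℝ} (hδ : Summable δ)
    (hintA : ∀ (K : ℕ) (t : ℝ) (s : SeqOfRecord F θ.ν θ.τ9.M (histA₁₃ θ K₀ g₀ K) (K₀ + K) (K₀ + K)),
      Integrable (fun V => chiSeqOfRecord F N θ.ν θ.τ9.M (histA₁₃ θ K₀ g₀ K) (K₀ + K) (K₀ + K) s V *
        dressedSlotsOfDatum₉ F N θ.toStage9Params (datumOfRecord₁₃CoPH F N θ hP) g₀ os t (runA₁₃ F K₀ g₀ K) (histA₁₃ θ K₀ g₀ K) (K₀ + K) s V)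
        (fieldMeasure (F.P (K₀ + K)) (K₀ + K) (Node00.SU N)))
    (hterm : ∀ K : ℕ, ∃ c : ℝ, ∀ t : ℝ, |t| ≤ 1 → ∀ s : SeqOfRecord F θ.ν θ.τ9.M (histA₁₃ θ K₀ g₀ K) (K₀ + K) (K₀ + K),
      (∀ j, 1 ≤ j → j ≤ jcut K → s.Λ j = Set.univ) →
      Real.exp (c - F.side ^ 4 * δ K) *
            (classWeightOfDatum₉ F N θ.toStage9Params (datumOfRecord₁₃CoPH F N θ hP) g₀ os (runA₁₃ F K₀ g₀ K) (histA₁₃ θ K₀ g₀ K) (K₀ + K) t s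
              - shellWeightOfDatum₉ F N θ.toStage9Params (datumOfRecord₁₃CoPH F N θ hP) g₀ os (runA₁₃ F K₀ g₀ K) (histA₁₃ θ K₀ g₀ K) (K₀ + K)
                  (ρA F θ hP g₀ os K) t s)
          ≤ classWeightOfDatum₉ F N θ.toStage9Params (datumOfRecord₁₃CoPH F N θ hP) g₀ os (runB₁₃ F K₀ g₀ K) (histB₁₃ θ K₀ g₀ K) (K₀ + K + 1) t
                (liftSeq F θ.ν hM (hR K) s)
              - shellWeightOfDatum₉ F N θ.toStage9Params (datumOfRecord₁₃CoPH F N θ hP) g₀ os (runB₁₃ F K₀ g₀ K) (histB₁₃ θ K₀ g₀ K) (K₀ + K + 1)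
                  (ρB F θ hP g₀ os K) t (liftSeq F θ.ν hM (hR K) s) ∧
        classWeightOfDatum₉ F N θ.toStage9Params (datumOfRecord₁₃CoPH F N θ hP) g₀ os (runB₁₃ F K₀ g₀ K) (histB₁₃ θ K₀ g₀ K) (K₀ + K + 1) t
                (liftSeq F θ.ν hM (hR K) s)
              - shellWeightOfDatum₉ F N θ.toStage9Params (datumOfRecord₁₃CoPH F N θ hP) g₀ os (runB₁₃ F K₀ g₀ K) (histB₁₃ θ K₀ g₀ K) (K₀ + K + 1)
                  (ρB F θ hP g₀ os K) t (liftSeq F θ.ν hM (hR K) s)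
          ≤ Real.exp (c + F.side ^ 4 * δ K) *
            (classWeightOfDatum₉ F N θ.toStage9Params (datumOfRecord₁₃CoPH F N θ hP) g₀ os (runA₁₃ F K₀ g₀ K) (histA₁₃ θ K₀ g₀ K) (K₀ + K) t s
              - shellWeightOfDatum₉ F N θ.toStage9Params (datumOfRecord₁₃CoPH F N θ hP) g₀ os (runA₁₃ F K₀ g₀ K) (histA₁₃ θ K₀ g₀ K) (K₀ + K)
                  (ρA F θ hP g₀ os K) t s)) :
    (letI := (crOfRecord₁₃VAt K₀ jcut (shellSplitOfRecord₁₃At N K₀ ρA ρB) F θ hP g₀ os).dec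
     NE7.Core (crOfRecord₁₃VAt K₀ jcut (shellSplitOfRecord₁₃At N K₀ ρA ρB) F θ hP g₀ os).l₀
      (crOfRecord₁₃VAt K₀ jcut (shellSplitOfRecord₁₃At N K₀ ρA ρB) F θ hP g₀ os).vol (crOfRecord₁₃VAt K₀ jcut (shellSplitOfRecord₁₃At N K₀ ρA ρB) F θ hP g₀ os).T
      (crOfRecord₁₃VAt K₀ jcut (shellSplitOfRecord₁₃At N K₀ ρA ρB) F θ hP g₀ os).Bad
      (fun K t τ => (crOfRecord₁₃VAt K₀ jcut (shellSplitOfRecord₁₃At N K₀ ρA ρB) F θ hP g₀ os).A K t τ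
        - (crOfRecord₁₃VAt K₀ jcut (shellSplitOfRecord₁₃At N K₀ ρA ρB) F θ hP g₀ os).shA K t τ)
      (fun K t τ => (crOfRecord₁₃VAt K₀ jcut (shellSplitOfRecord₁₃At N K₀ ρA ρB) F θ hP g₀ os).B K t τ
        - (crOfRecord₁₃VAt K₀ jcut (shellSplitOfRecord₁₃At N K₀ ρA ρB) F θ hP g₀ os).shB K t τ)
      (crOfRecord₁₃VAt K₀ jcut (shellSplitOfRecord₁₃At N K₀ ρA ρB) F θ hP g₀ os).δ) ∧
      Summable (crOfRecord₁₃VAt K₀ jcut (shellSplitOfRecord₁₃At N K₀ ρA ρB) F θ hP g₀ os).δ :=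
  core_crOfRecord₁₃VAt K₀ jcut (shellSplitOfRecord₁₃At N K₀ ρA ρB) θ hP g₀ os
    (fun K t _ x _ => weightA₁₃_sub_shellA₁₃_nonneg θ hP K₀ g₀ os (ρA F θ hP g₀ os) hintA K t x)
    ((core_shellSplit₁₃_iff_termCore θ hP K₀ g₀ os hM hR jcut hj1 hjK (ρA F θ hP g₀ os) (ρB F θ hP g₀ os) 1 (F.side ^ 4) δ).2 hterm) hδ

/-- **★★ THE SAME AT THE PHYSICAL-VOLUME READING `crOfRecord₁₃VAt K₀ jcut (shellSplitOfRecord₁₃At N K₀ ρA ρB)` FROM THE LOWERED-THRESHOLD SANDWICH** (exponents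
`c ∓ F.side^4·δ K`; dag-n20-d's `core_crOfRecord₁₃VAt`). [cite: King1986, (3.10) p.656; Balaban1989LargeFieldII, Thm 1 + (0.1) pp.355–356, (1.80) p.384; Balaban1988Convergent, (2.17)–(2.18) p.257 (bookkeeping)] -/
theorem core_crOfRecord₁₃VAt_shellSplit_of_loweredTerm (hR : ∀ K, RAgree F θ.ν (histA₁₃ θ K₀ g₀ K) (histB₁₃ θ K₀ g₀ K) (K₀ + K))
    (jcut : ℕ → ℕ) (hj1 : ∀ K, 1 ≤ jcut K) (hjK : ∀ K, jcut K ≤ K₀ + K) (ρA ρB : WidthLetter₁₃CoPH N) {δ : ℕ → ℝ} (hδ : Summable δ)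
    (hU : LocalBgMeasurable F N θ.ν)
    (hρA : ∀ K, 0 ≤ epsOfRecord θ.ν (histA₁₃ θ K₀ g₀ K) (K₀ + K) * ρA F θ hP g₀ os K)
    (hρB : ∀ K, 0 ≤ epsOfRecord θ.ν (histB₁₃ θ K₀ g₀ K) (K₀ + K + 1) * ρB F θ hP g₀ os K)
    (hintA : ∀ (K : ℕ) (t : ℝ) (s : SeqOfRecord F θ.ν θ.τ9.M (histA₁₃ θ K₀ g₀ K) (K₀ + K) (K₀ + K)),
      Integrable (fun V => chiSeqOfRecord F N θ.ν θ.τ9.M (histA₁₃ θ K₀ g₀ K) (K₀ + K) (K₀ + K) s V *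
        dressedSlotsOfDatum₉ F N θ.toStage9Params (datumOfRecord₁₃CoPH F N θ hP) g₀ os t (runA₁₃ F K₀ g₀ K) (histA₁₃ θ K₀ g₀ K) (K₀ + K) s V)
        (fieldMeasure (F.P (K₀ + K)) (K₀ + K) (Node00.SU N)))
    (hintB : ∀ (K : ℕ) (t : ℝ) (s' : SeqOfRecord F θ.ν θ.τ9.M (histB₁₃ θ K₀ g₀ K) (K₀ + K + 1) (K₀ + K + 1)),
      Integrable (fun V => chiSeqOfRecord F N θ.ν θ.τ9.M (histB₁₃ θ K₀ g₀ K) (K₀ + K + 1) (K₀ + K + 1) s' V *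
        dressedSlotsOfDatum₉ F N θ.toStage9Params (datumOfRecord₁₃CoPH F N θ hP) g₀ os t (runB₁₃ F K₀ g₀ K) (histB₁₃ θ K₀ g₀ K) (K₀ + K + 1) s' V)
        (fieldMeasure (F.P (K₀ + K + 1)) (K₀ + K + 1) (Node00.SU N)))
    (hlow : ∀ K : ℕ, ∃ c : ℝ, ∀ t : ℝ, |t| ≤ 1 → ∀ s : SeqOfRecord F θ.ν θ.τ9.M (histA₁₃ θ K₀ g₀ K) (K₀ + K) (K₀ + K),
      (∀ j, 1 ≤ j → j ≤ jcut K → s.Λ j = Set.univ) →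
      Real.exp (c - F.side ^ 4 * δ K) *
            (∫ V, chiSeqOfRecordAt F N θ.ν θ.τ9.M (histA₁₃ θ K₀ g₀ K) (K₀ + K) (K₀ + K)
                (epsOfRecord θ.ν (histA₁₃ θ K₀ g₀ K) (K₀ + K) * (1 - ρA F θ hP g₀ os K)) s V *
              dressedSlotsOfDatum₉ F N θ.toStage9Params (datumOfRecord₁₃CoPH F N θ hP) g₀ os t (runA₁₃ F K₀ g₀ K) (histA₁₃ θ K₀ g₀ K) (K₀ + K) s V
              ∂fieldMeasure (F.P (K₀ + K)) (K₀ + K) (Node00.SU N))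
          ≤ (∫ V, chiSeqOfRecordAt F N θ.ν θ.τ9.M (histB₁₃ θ K₀ g₀ K) (K₀ + K + 1) (K₀ + K + 1)
                (epsOfRecord θ.ν (histB₁₃ θ K₀ g₀ K) (K₀ + K + 1) * (1 - ρB F θ hP g₀ os K)) (liftSeq F θ.ν hM (hR K) s) V *
              dressedSlotsOfDatum₉ F N θ.toStage9Params (datumOfRecord₁₃CoPH F N θ hP) g₀ os t (runB₁₃ F K₀ g₀ K) (histB₁₃ θ K₀ g₀ K) (K₀ + K + 1)
                (liftSeq F θ.ν hM (hR K) s) V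
              ∂fieldMeasure (F.P (K₀ + K + 1)) (K₀ + K + 1) (Node00.SU N)) ∧
        (∫ V, chiSeqOfRecordAt F N θ.ν θ.τ9.M (histB₁₃ θ K₀ g₀ K) (K₀ + K + 1) (K₀ + K + 1)
                (epsOfRecord θ.ν (histB₁₃ θ K₀ g₀ K) (K₀ + K + 1) * (1 - ρB F θ hP g₀ os K)) (liftSeq F θ.ν hM (hR K) s) V *
              dressedSlotsOfDatum₉ F N θ.toStage9Params (datumOfRecord₁₃CoPH F N θ hP) g₀ os t (runB₁₃ F K₀ g₀ K) (histB₁₃ θ K₀ g₀ K) (K₀ + K + 1)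
                (liftSeq F θ.ν hM (hR K) s) V
              ∂fieldMeasure (F.P (K₀ + K + 1)) (K₀ + K + 1) (Node00.SU N))
          ≤ Real.exp (c + F.side ^ 4 * δ K) *
            (∫ V, chiSeqOfRecordAt F N θ.ν θ.τ9.M (histA₁₃ θ K₀ g₀ K) (K₀ + K) (K₀ + K)
                (epsOfRecord θ.ν (histA₁₃ θ K₀ g₀ K) (K₀ + K) * (1 - ρA F θ hP g₀ os K)) s V *
              dressedSlotsOfDatum₉ F N θ.toStage9Params (datumOfRecord₁₃CoPH F N θ hP) g₀ os t (runA₁₃ F K₀ g₀ K) (histA₁₃ θ K₀ g₀ K) (K₀ + K) s V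
              ∂fieldMeasure (F.P (K₀ + K)) (K₀ + K) (Node00.SU N))) :
    (letI := (crOfRecord₁₃VAt K₀ jcut (shellSplitOfRecord₁₃At N K₀ ρA ρB) F θ hP g₀ os).dec
     NE7.Core (crOfRecord₁₃VAt K₀ jcut (shellSplitOfRecord₁₃At N K₀ ρA ρB) F θ hP g₀ os).l₀
      (crOfRecord₁₃VAt K₀ jcut (shellSplitOfRecord₁₃At N K₀ ρA ρB) F θ hP g₀ os).vol (crOfRecord₁₃VAt K₀ jcut (shellSplitOfRecord₁₃At N K₀ ρA ρB) F θ hP g₀ os).T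
      (crOfRecord₁₃VAt K₀ jcut (shellSplitOfRecord₁₃At N K₀ ρA ρB) F θ hP g₀ os).Bad
      (fun K t τ => (crOfRecord₁₃VAt K₀ jcut (shellSplitOfRecord₁₃At N K₀ ρA ρB) F θ hP g₀ os).A K t τ
        - (crOfRecord₁₃VAt K₀ jcut (shellSplitOfRecord₁₃At N K₀ ρA ρB) F θ hP g₀ os).shA K t τ)
      (fun K t τ => (crOfRecord₁₃VAt K₀ jcut (shellSplitOfRecord₁₃At N K₀ ρA ρB) F θ hP g₀ os).B K t τ
        - (crOfRecord₁₃VAt K₀ jcut (shellSplitOfRecord₁₃At N K₀ ρA ρB) F θ hP g₀ os).shB K t τ)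
      (crOfRecord₁₃VAt K₀ jcut (shellSplitOfRecord₁₃At N K₀ ρA ρB) F θ hP g₀ os).δ) ∧
      Summable (crOfRecord₁₃VAt K₀ jcut (shellSplitOfRecord₁₃At N K₀ ρA ρB) F θ hP g₀ os).δ :=
  core_crOfRecord₁₃VAt K₀ jcut (shellSplitOfRecord₁₃At N K₀ ρA ρB) θ hP g₀ os
    (fun K t _ x _ => weightA₁₃_sub_shellA₁₃_nonneg θ hP K₀ g₀ os (ρA F θ hP g₀ os) hintA K t x)
    ((core_shellSplit₁₃_iff_loweredTerm θ hP K₀ g₀ os hM hR jcut hj1 hjK (ρA F θ hP g₀ os) (ρB F θ hP g₀ os) 1 (F.side ^ 4) δ hU hρA hρB hintA hintB).2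
      hlow) hδ


end AtReading

/-! ## §4 ON THE LIVE-SELECTOR LINE (K3⁷ v2's `PinnedAtLive` line): F3's (e1) integrability is dag-n21-d's theorem — the core-edge conjunct at the split of record
from the lowered-threshold sandwich, (H-U), (H-ζ), the widths' sign and `Summable δ`, NOTHING ELSE -/

section LiveLine

variable (hM : 0 < θ.τ9.M)

/-- **★★★ ON THE LIVE-SELECTOR LINE, N19′'s CORE EDGE AT `crOfRecord₁₃At K₀ jcut (shellSplitOfRecord₁₃At N K₀ ρA ρB)` FROM THE LOWERED-THRESHOLD SANDWICH ALONE.**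
DISPLAYED: the live-selector pin `hsel` (= K3⁷ v2's `LiveSel`, the line on which dag-n20-d's `keyedExtraction_crOfRecord₁₃At` makes N27x a theorem), (H-U) `LocalBgMeasurable`,
(H-ζ) `ZetaMeasurable`, `hM`, the flow hypothesis `hR`, the policy letters, the widths' sign, a summable `δ` — and THE SANDWICH of the two runs' (2.18) terms re-tested at the
lowered thresholds, term vs lifted term, on the small-field-at-old-levels histories (N19's NE7 core at the record; NOT PRINTED, NOT proved).  F3's (e1) integrability of the top
pieces is dag-n21-d's `integrable_topPieceA_of_liveSel ∕ …B…` (p593341), its `0 ≤ ζ` letter the provisos' ζ-rows (n20-w2's `zeta_nonneg_of_provisos₁₃CoPH`).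
[cite: King1986, (3.10) p.656; Balaban1989LargeFieldII, Thm 1 + (0.1) pp.355–356, (1.80) p.384; Balaban1988Convergent, (2.17)–(2.18) p.257; Balaban1989LargeFieldI, (0.3) p.176, p.193 (bookkeeping)] -/
theorem core_crOfRecord₁₃At_shellSplit_of_loweredTerm_liveSel (hR : ∀ K, RAgree F θ.ν (histA₁₃ θ K₀ g₀ K) (histB₁₃ θ K₀ g₀ K) (K₀ + K))
    (jcut : ℕ → ℕ) (hj1 : ∀ K, 1 ≤ jcut K) (hjK : ∀ K, jcut K ≤ K₀ + K) (ρA ρB : WidthLetter₁₃CoPH N) {δ : ℕ → ℝ} (hδ : Summable δ)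
    (E : B12.RunParams → ℝ) (hsel : θ.ppSel = ppSelLiveOfRecord F N θ.ν θ.τ9 E (wOfRecord₉ F N θ.toStage9Params))
    (hU : LocalBgMeasurable F N θ.ν) (hζm : ZetaMeasurable F N θ.ζ)
    (hρA : ∀ K, 0 ≤ epsOfRecord θ.ν (histA₁₃ θ K₀ g₀ K) (K₀ + K) * ρA F θ hP g₀ os K)
    (hρB : ∀ K, 0 ≤ epsOfRecord θ.ν (histB₁₃ θ K₀ g₀ K) (K₀ + K + 1) * ρB F θ hP g₀ os K)
    (hlow : ∀ K : ℕ, ∃ c : ℝ, ∀ t : ℝ, |t| ≤ 1 → ∀ s : SeqOfRecord F θ.ν θ.τ9.M (histA₁₃ θ K₀ g₀ K) (K₀ + K) (K₀ + K),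
      (∀ j, 1 ≤ j → j ≤ jcut K → s.Λ j = Set.univ) →
      Real.exp (c - 1 * δ K) *
            (∫ V, chiSeqOfRecordAt F N θ.ν θ.τ9.M (histA₁₃ θ K₀ g₀ K) (K₀ + K) (K₀ + K)
                (epsOfRecord θ.ν (histA₁₃ θ K₀ g₀ K) (K₀ + K) * (1 - ρA F θ hP g₀ os K)) s V *
              dressedSlotsOfDatum₉ F N θ.toStage9Params (datumOfRecord₁₃CoPH F N θ hP) g₀ os t (runA₁₃ F K₀ g₀ K) (histA₁₃ θ K₀ g₀ K) (K₀ + K) s V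
              ∂fieldMeasure (F.P (K₀ + K)) (K₀ + K) (Node00.SU N))
          ≤ (∫ V, chiSeqOfRecordAt F N θ.ν θ.τ9.M (histB₁₃ θ K₀ g₀ K) (K₀ + K + 1) (K₀ + K + 1)
                (epsOfRecord θ.ν (histB₁₃ θ K₀ g₀ K) (K₀ + K + 1) * (1 - ρB F θ hP g₀ os K)) (liftSeq F θ.ν hM (hR K) s) V *
              dressedSlotsOfDatum₉ F N θ.toStage9Params (datumOfRecord₁₃CoPH F N θ hP) g₀ os t (runB₁₃ F K₀ g₀ K) (histB₁₃ θ K₀ g₀ K) (K₀ + K + 1)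
                (liftSeq F θ.ν hM (hR K) s) V
              ∂fieldMeasure (F.P (K₀ + K + 1)) (K₀ + K + 1) (Node00.SU N)) ∧
        (∫ V, chiSeqOfRecordAt F N θ.ν θ.τ9.M (histB₁₃ θ K₀ g₀ K) (K₀ + K + 1) (K₀ + K + 1)
                (epsOfRecord θ.ν (histB₁₃ θ K₀ g₀ K) (K₀ + K + 1) * (1 - ρB F θ hP g₀ os K)) (liftSeq F θ.ν hM (hR K) s) V *
              dressedSlotsOfDatum₉ F N θ.toStage9Params (datumOfRecord₁₃CoPH F N θ hP) g₀ os t (runB₁₃ F K₀ g₀ K) (histB₁₃ θ K₀ g₀ K) (K₀ + K + 1)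
                (liftSeq F θ.ν hM (hR K) s) V
              ∂fieldMeasure (F.P (K₀ + K + 1)) (K₀ + K + 1) (Node00.SU N))
          ≤ Real.exp (c + 1 * δ K) *
            (∫ V, chiSeqOfRecordAt F N θ.ν θ.τ9.M (histA₁₃ θ K₀ g₀ K) (K₀ + K) (K₀ + K)
                (epsOfRecord θ.ν (histA₁₃ θ K₀ g₀ K) (K₀ + K) * (1 - ρA F θ hP g₀ os K)) s V *
              dressedSlotsOfDatum₉ F N θ.toStage9Params (datumOfRecord₁₃CoPH F N θ hP) g₀ os t (runA₁₃ F K₀ g₀ K) (histA₁₃ θ K₀ g₀ K) (K₀ + K) s V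
              ∂fieldMeasure (F.P (K₀ + K)) (K₀ + K) (Node00.SU N))) :
    (letI := (crOfRecord₁₃At K₀ jcut (shellSplitOfRecord₁₃At N K₀ ρA ρB) F θ hP g₀ os).dec
     NE7.Core (crOfRecord₁₃At K₀ jcut (shellSplitOfRecord₁₃At N K₀ ρA ρB) F θ hP g₀ os).l₀
      (crOfRecord₁₃At K₀ jcut (shellSplitOfRecord₁₃At N K₀ ρA ρB) F θ hP g₀ os).vol (crOfRecord₁₃At K₀ jcut (shellSplitOfRecord₁₃At N K₀ ρA ρB) F θ hP g₀ os).T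
      (crOfRecord₁₃At K₀ jcut (shellSplitOfRecord₁₃At N K₀ ρA ρB) F θ hP g₀ os).Bad
      (fun K t τ => (crOfRecord₁₃At K₀ jcut (shellSplitOfRecord₁₃At N K₀ ρA ρB) F θ hP g₀ os).A K t τ
        - (crOfRecord₁₃At K₀ jcut (shellSplitOfRecord₁₃At N K₀ ρA ρB) F θ hP g₀ os).shA K t τ)
      (fun K t τ => (crOfRecord₁₃At K₀ jcut (shellSplitOfRecord₁₃At N K₀ ρA ρB) F θ hP g₀ os).B K t τ
        - (crOfRecord₁₃At K₀ jcut (shellSplitOfRecord₁₃At N K₀ ρA ρB) F θ hP g₀ os).shB K t τ)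
      (crOfRecord₁₃At K₀ jcut (shellSplitOfRecord₁₃At N K₀ ρA ρB) F θ hP g₀ os).δ) ∧
      Summable (crOfRecord₁₃At K₀ jcut (shellSplitOfRecord₁₃At N K₀ ρA ρB) F θ hP g₀ os).δ :=
  core_crOfRecord₁₃At_shellSplit_of_loweredTerm θ hP K₀ g₀ os hM hR jcut hj1 hjK ρA ρB hδ hU hρA hρB
    (integrable_topPieceA_of_liveSel K₀ θ hP E hsel hU hζm (zeta_nonneg_of_provisos₁₃CoPH F θ hP) g₀ os)
    (integrable_topPieceB_of_liveSel K₀ θ hP E hsel hU hζm (zeta_nonneg_of_provisos₁₃CoPH F θ hP) g₀ os) hlow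

/-- **★★★ THE SAME AT THE PHYSICAL-VOLUME READING `crOfRecord₁₃VAt K₀ jcut (shellSplitOfRecord₁₃At N K₀ ρA ρB)`** (exponents `c ∓ F.side^4·δ K`) — the edition K3⁷ v3
pins (plan g81 (w18)). [cite: King1986, (3.10) p.656; Balaban1989LargeFieldII, Thm 1 + (0.1) pp.355–356, (1.80) p.384; Balaban1988Convergent, (2.17)–(2.18) p.257 (bookkeeping)] -/
theorem core_crOfRecord₁₃VAt_shellSplit_of_loweredTerm_liveSel (hR : ∀ K, RAgree F θ.ν (histA₁₃ θ K₀ g₀ K) (histB₁₃ θ K₀ g₀ K) (K₀ + K))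
    (jcut : ℕ → ℕ) (hj1 : ∀ K, 1 ≤ jcut K) (hjK : ∀ K, jcut K ≤ K₀ + K) (ρA ρB : WidthLetter₁₃CoPH N) {δ : ℕ → ℝ} (hδ : Summable δ)
    (E : B12.RunParams → ℝ) (hsel : θ.ppSel = ppSelLiveOfRecord F N θ.ν θ.τ9 E (wOfRecord₉ F N θ.toStage9Params))
    (hU : LocalBgMeasurable F N θ.ν) (hζm : ZetaMeasurable F N θ.ζ)
    (hρA : ∀ K, 0 ≤ epsOfRecord θ.ν (histA₁₃ θ K₀ g₀ K) (K₀ + K) * ρA F θ hP g₀ os K)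
    (hρB : ∀ K, 0 ≤ epsOfRecord θ.ν (histB₁₃ θ K₀ g₀ K) (K₀ + K + 1) * ρB F θ hP g₀ os K)
    (hlow : ∀ K : ℕ, ∃ c : ℝ, ∀ t : ℝ, |t| ≤ 1 → ∀ s : SeqOfRecord F θ.ν θ.τ9.M (histA₁₃ θ K₀ g₀ K) (K₀ + K) (K₀ + K),
      (∀ j, 1 ≤ j → j ≤ jcut K → s.Λ j = Set.univ) →
      Real.exp (c - F.side ^ 4 * δ K) *
            (∫ V, chiSeqOfRecordAt F N θ.ν θ.τ9.M (histA₁₃ θ K₀ g₀ K) (K₀ + K) (K₀ + K)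
                (epsOfRecord θ.ν (histA₁₃ θ K₀ g₀ K) (K₀ + K) * (1 - ρA F θ hP g₀ os K)) s V *
              dressedSlotsOfDatum₉ F N θ.toStage9Params (datumOfRecord₁₃CoPH F N θ hP) g₀ os t (runA₁₃ F K₀ g₀ K) (histA₁₃ θ K₀ g₀ K) (K₀ + K) s V
              ∂fieldMeasure (F.P (K₀ + K)) (K₀ + K) (Node00.SU N))
          ≤ (∫ V, chiSeqOfRecordAt F N θ.ν θ.τ9.M (histB₁₃ θ K₀ g₀ K) (K₀ + K + 1) (K₀ + K + 1)
                (epsOfRecord θ.ν (histB₁₃ θ K₀ g₀ K) (K₀ + K + 1) * (1 - ρB F θ hP g₀ os K)) (liftSeq F θ.ν hM (hR K) s) V *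
              dressedSlotsOfDatum₉ F N θ.toStage9Params (datumOfRecord₁₃CoPH F N θ hP) g₀ os t (runB₁₃ F K₀ g₀ K) (histB₁₃ θ K₀ g₀ K) (K₀ + K + 1)
                (liftSeq F θ.ν hM (hR K) s) V
              ∂fieldMeasure (F.P (K₀ + K + 1)) (K₀ + K + 1) (Node00.SU N)) ∧
        (∫ V, chiSeqOfRecordAt F N θ.ν θ.τ9.M (histB₁₃ θ K₀ g₀ K) (K₀ + K + 1) (K₀ + K + 1)
                (epsOfRecord θ.ν (histB₁₃ θ K₀ g₀ K) (K₀ + K + 1) * (1 - ρB F θ hP g₀ os K)) (liftSeq F θ.ν hM (hR K) s) V *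
              dressedSlotsOfDatum₉ F N θ.toStage9Params (datumOfRecord₁₃CoPH F N θ hP) g₀ os t (runB₁₃ F K₀ g₀ K) (histB₁₃ θ K₀ g₀ K) (K₀ + K + 1)
                (liftSeq F θ.ν hM (hR K) s) V
              ∂fieldMeasure (F.P (K₀ + K + 1)) (K₀ + K + 1) (Node00.SU N))
          ≤ Real.exp (c + F.side ^ 4 * δ K) *
            (∫ V, chiSeqOfRecordAt F N θ.ν θ.τ9.M (histA₁₃ θ K₀ g₀ K) (K₀ + K) (K₀ + K)
                (epsOfRecord θ.ν (histA₁₃ θ K₀ g₀ K) (K₀ + K) * (1 - ρA F θ hP g₀ os K)) s V *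
              dressedSlotsOfDatum₉ F N θ.toStage9Params (datumOfRecord₁₃CoPH F N θ hP) g₀ os t (runA₁₃ F K₀ g₀ K) (histA₁₃ θ K₀ g₀ K) (K₀ + K) s V
              ∂fieldMeasure (F.P (K₀ + K)) (K₀ + K) (Node00.SU N))) :
    (letI := (crOfRecord₁₃VAt K₀ jcut (shellSplitOfRecord₁₃At N K₀ ρA ρB) F θ hP g₀ os).dec
     NE7.Core (crOfRecord₁₃VAt K₀ jcut (shellSplitOfRecord₁₃At N K₀ ρA ρB) F θ hP g₀ os).l₀
      (crOfRecord₁₃VAt K₀ jcut (shellSplitOfRecord₁₃At N K₀ ρA ρB) F θ hP g₀ os).vol (crOfRecord₁₃VAt K₀ jcut (shellSplitOfRecord₁₃At N K₀ ρA ρB) F θ hP g₀ os).T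
      (crOfRecord₁₃VAt K₀ jcut (shellSplitOfRecord₁₃At N K₀ ρA ρB) F θ hP g₀ os).Bad
      (fun K t τ => (crOfRecord₁₃VAt K₀ jcut (shellSplitOfRecord₁₃At N K₀ ρA ρB) F θ hP g₀ os).A K t τ
        - (crOfRecord₁₃VAt K₀ jcut (shellSplitOfRecord₁₃At N K₀ ρA ρB) F θ hP g₀ os).shA K t τ)
      (fun K t τ => (crOfRecord₁₃VAt K₀ jcut (shellSplitOfRecord₁₃At N K₀ ρA ρB) F θ hP g₀ os).B K t τ
        - (crOfRecord₁₃VAt K₀ jcut (shellSplitOfRecord₁₃At N K₀ ρA ρB) F θ hP g₀ os).shB K t τ)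
      (crOfRecord₁₃VAt K₀ jcut (shellSplitOfRecord₁₃At N K₀ ρA ρB) F θ hP g₀ os).δ) ∧
      Summable (crOfRecord₁₃VAt K₀ jcut (shellSplitOfRecord₁₃At N K₀ ρA ρB) F θ hP g₀ os).δ :=
  core_crOfRecord₁₃VAt_shellSplit_of_loweredTerm θ hP K₀ g₀ os hM hR jcut hj1 hjK ρA ρB hδ hU hρA hρB
    (integrable_topPieceA_of_liveSel K₀ θ hP E hsel hU hζm (zeta_nonneg_of_provisos₁₃CoPH F θ hP) g₀ os)
    (integrable_topPieceB_of_liveSel K₀ θ hP E hsel hU hζm (zeta_nonneg_of_provisos₁₃CoPH F θ hP) g₀ os) hlow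

end LiveLine

end Summit.QuantumFields.YangMills.BalabanUVNodes.N20CoreEdgeAtShellSplitTransfer

end
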